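import Summits.RiemannHypothesis.RiemannHypothesis.Theorems.WeilFormatCCinfArchMonomials
import Summits.RiemannHypothesis.RiemannHypothesis.Theorems.WeilFormatCPolyWindowMixedRealFamilies
import HarnessLib

/-!
# Format C, design C∞ (E3, analytic side): the images `Re/Im W_a(1x^q, χ_m)` as MONOMIAL sums in the four tags

Route context: Fourier–Galerkin / Schur-complement certificates of Weil positivity on a window ("format C", C∞ door;
cell memo `run/shared/lean/pub/rh-explicit/rh-explicit-weil-10/KERNEL-LEVER.md` §21; supporting stmt-RiemannHypothesis-0098;
seat rh-explicit-weil-10).  `re/im_weilWindowSesq_indicator_pow_chi` (`WeilFormatCPolyWindowMixedRealFamilies`) write the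
image of the window power `x^q` against the character `χ_m` over `{polar factor, 1, G_m, F_m}` with
`G_m = J_c(m) − C_m`, `F_m = J_s(m) + S_m` (`C_m`, `S_m` the prime cosine/sine sums).  Substituting the monomial forms of
`J_s`, `J_c` (`abs_archSin/Cos_sub_monomials_le`) and of the polar factors (`abs_polarFactor_int_sub_sum_le`,
`abs_oddPolarFactor_int_sub_sum_le`) gives, for natural modes `m ≥ m₀` (`πm₀/a ≥ 2`) and a uniform order `E`
(`E + 1 ≤ 2ν`, `E ≤ K`, `E ≤ 2R`, `E + 1 ≤ 2J + 2` resp. `E ≤ 2J`):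

* `abs_re_image_pow_sub_monomials_le` — `Re W_a(1x^q, χ_m) = (2a)^{-1/2}(−1)^m·[the RealFamilies bracket with`
  `1/(1+4ω²) ↦ Σ_{r<J}(−1)^r (a²/4π²)^{r+1}/m^{2r+2}`, `J_c ↦ ½log m + κ_c + Σ_N c_N b_N(a/2π)^N/m^N + Σ_r(−1)^r D_{2r+1}(a/π)^{2r+2}/m^{2r+2}`,
  `J_s ↦ π/4 + Σ_N σ_N b_N (a/2π)^N/m^N − Σ_r (−1)^r D_{2r}(a/π)^{2r+1}/m^{2r+1}] ± (2a)^{-1/2}·ρ_re(q, m₀)·(m₀/m)^{E+1}`;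
* `abs_im_image_pow_sub_monomials_le` — the same for `Im W_a(1x^q, χ_m)` with the odd polar factor
  `ω/(1+4ω²) ↦ Σ_{r<J}(−1)^r (a/4π)(a²/4π²)^r/m^{2r+1}`,

with `ρ(q, m₀) = |polar constant|·(polar tail at m₀) + Σ_{k≤q} q^{(k)}(a/(πm₀))^{k+1}(|α_k|·remC(m₀) + |β_k|·remS(m₀))`
— every far image of the C∞ coupling column is thus `(−1)^m ×` a finite list of monomials `c·T(m)/m^e`,
`T ∈ {1, log m, S_m, C_m}`, whose coefficients are finite sums of the printed constants (the generator collects them by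
`(T, e)`), plus ONE remainder constant evaluated at `m₀ = B₃`.  Tool: the abstract substitution template
`abs_sub_le_of_image_template`.  Pure algebra over the landed identities; standard axioms; no definitions; no RH claim.
-/

set_option autoImplicit false
-- `Summit.RiemannHypothesis.RiemannHypothesis.…` is the layout-mandated namespace (summit = problem name).
set_option linter.dupNamespace false

noncomputable section

open Complex Filter Set MeasureTheory
open scoped Real Topology ComplexConjugate ArithmeticFunction.vonMangoldt

namespace Summit.RiemannHypothesis.RiemannHypothesis.Theorems.WeilFormatC

open Literature.NumberTheory.LFunctions Literature.NumberTheory.LFunctions.Yoshida1992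
  Literature.Analysis.SpecialFunctions

variable {a : ℝ}

/-! ## The substitution template -/

/-- **Substitution template for the images.**  If
`X = c₀ε(A·P + Σ_{k<n} w_k (K_k + α_k(J_c − C) + β_k(J_s + S)))` with `0 ≤ c₀`, `|ε| = 1`, and `P`, `J_c`, `J_s` are
approximated by `P'`, `J_c'`, `J_s'` within `ρ_P·y`, `ρ_C·y`, `ρ_S·y`, and `|w_k| ≤ W_k`, then `X` is within
`c₀(|A|ρ_P + Σ_k W_k(|α_k|ρ_C + |β_k|ρ_S))·y` of the same expression with the approximants substituted. -/
theorem abs_sub_le_of_image_template {n : ℕ} {c₀ ε A P P' Jc Jc' Js Js' C S y ρP ρC ρS X : ℝ}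
    {w K α β W : ℕ → ℝ} (hc₀ : 0 ≤ c₀) (hε : |ε| = 1)
    (hX : X = c₀ * ε * (A * P + ∑ k ∈ Finset.range n, w k * (K k + α k * (Jc - C) + β k * (Js + S))))
    (hP : |P - P'| ≤ ρP * y) (hC : |Jc - Jc'| ≤ ρC * y) (hS : |Js - Js'| ≤ ρS * y)
    (hw : ∀ k ∈ Finset.range n, |w k| ≤ W k) :
    |X - c₀ * ε * (A * P' + ∑ k ∈ Finset.range n, w k * (K k + α k * (Jc' - C) + β k * (Js' + S)))|
      ≤ c₀ * (|A| * ρP + ∑ k ∈ Finset.range n, W k * (|α k| * ρC + |β k| * ρS)) * y := by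
  have hsum : ∑ k ∈ Finset.range n, w k * (K k + α k * (Jc - C) + β k * (Js + S))
      - ∑ k ∈ Finset.range n, w k * (K k + α k * (Jc' - C) + β k * (Js' + S))
      = ∑ k ∈ Finset.range n, w k * (α k * (Jc - Jc') + β k * (Js - Js')) := by
    rw [← Finset.sum_sub_distrib]
    exact Finset.sum_congr rfl fun k _ ↦ by ring
  have hdiff : X - c₀ * ε * (A * P' + ∑ k ∈ Finset.range n, w k * (K k + α k * (Jc' - C) + β k * (Js' + S)))
      = c₀ * ε * (A * (P - P') + ∑ k ∈ Finset.range n, w k * (α k * (Jc - Jc') + β k * (Js - Js'))) := by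
    rw [hX, ← hsum]; ring
  rw [hdiff, abs_mul, abs_mul, abs_of_nonneg hc₀, hε, mul_one, mul_assoc]
  refine mul_le_mul_of_nonneg_left ?_ hc₀
  calc |A * (P - P') + ∑ k ∈ Finset.range n, w k * (α k * (Jc - Jc') + β k * (Js - Js'))|
      ≤ |A * (P - P')| + |∑ k ∈ Finset.range n, w k * (α k * (Jc - Jc') + β k * (Js - Js'))| := abs_add_le _ _
    _ ≤ |A| * (ρP * y) + ∑ k ∈ Finset.range n, W k * (|α k| * (ρC * y) + |β k| * (ρS * y)) := by
        refine add_le_add ?_ ((Finset.abs_sum_le_sum_abs _ _).trans (Finset.sum_le_sum fun k hk ↦ ?_))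
        · rw [abs_mul]; exact mul_le_mul_of_nonneg_left hP (abs_nonneg _)
        · rw [abs_mul]
          refine mul_le_mul (hw k hk) ?_ (abs_nonneg _) ((abs_nonneg _).trans (hw k hk))
          calc |α k * (Jc - Jc') + β k * (Js - Js')| ≤ |α k * (Jc - Jc')| + |β k * (Js - Js')| := abs_add_le _ _
            _ ≤ |α k| * (ρC * y) + |β k| * (ρS * y) := by
                rw [abs_mul, abs_mul]
                exact add_le_add (mul_le_mul_of_nonneg_left hC (abs_nonneg _))
                  (mul_le_mul_of_nonneg_left hS (abs_nonneg _))
    _ = (|A| * ρP + ∑ k ∈ Finset.range n, W k * (|α k| * ρC + |β k| * ρS)) * y := by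
        rw [add_mul, Finset.sum_mul]
        congr 1
        · ring
        · exact Finset.sum_congr rfl fun k _ ↦ by ring

/-- **The image weights are dominated at `m₀`**: for `0 < m₀ ≤ m`,
`|(−1)^k q^{(k)} (a/(πm))^{k+1}| ≤ q^{(k)} (a/(πm₀))^{k+1}` (`a > 0`). -/
theorem abs_imageWeight_le (ha : 0 < a) {m₀ m : ℝ} (hm₀ : 0 < m₀) (hm : m₀ ≤ m) (q k : ℕ) :
    |(-1 : ℝ) ^ k * (q.descFactorial k : ℝ) * (a / (π * m)) ^ (k + 1)|
      ≤ (q.descFactorial k : ℝ) * (a / (π * m₀)) ^ (k + 1) := by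
  have hm' : 0 < m := hm₀.trans_le hm
  rw [abs_mul, abs_mul, abs_pow, abs_neg, abs_one, one_pow, one_mul, Nat.abs_cast,
    abs_of_nonneg (pow_nonneg (div_nonneg ha.le (by positivity)) _)]
  refine mul_le_mul_of_nonneg_left (pow_le_pow_left₀ (div_nonneg ha.le (by positivity)) ?_ _) (Nat.cast_nonneg _)
  exact div_le_div_of_nonneg_left ha.le (by positivity) (mul_le_mul_of_nonneg_left hm Real.pi_pos.le)


/-! ## The even images `Re W_a(1x^q, χ_m)` -/

/-- **The real part of the image of `x^q` as a monomial sum** (`a > 0`; natural modes `m ≥ m₀`, `πm₀/a ≥ 2`;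
`ν ≥ 1`, `2ν ≤ K`; uniform order `E` with `E + 1 ≤ 2ν`, `E ≤ K`, `E ≤ 2R`, `E + 1 ≤ 2J + 2`): the formula of
`re_weilWindowSesq_indicator_pow_chi` with the polar factor, `J_c(m)` and `J_s(m)` replaced by their monomial sums,
up to `(2a)^{-1/2}·ρ_re(q,m₀)·(m₀/m)^{E+1}`. -/
theorem abs_re_image_pow_sub_monomials_le (ha : 0 < a) {m₀ m : ℕ} (hm₀ : 2 ≤ π * m₀ / a) (hmm : m₀ ≤ m)
    (q : ℕ) {ν : ℕ} (hν : ν ≠ 0) {K : ℕ} (hK : 2 * ν ≤ K) (R J : ℕ) {E : ℕ} (hE1 : E + 1 ≤ 2 * ν)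
    (hE2 : E ≤ K) (hE3 : E ≤ 2 * R) (hEJ : E + 1 ≤ 2 * J + 2) :
    |(weilWindowSesq a ((Icc (-a) a).indicator fun x : ℝ ↦ ((x : ℂ)) ^ q) (chi a m)).re
        - (1 / Real.sqrt (2 * a)) * (-1 : ℝ) ^ m *
          ( (4 * (∫ x in (-a)..a, x ^ q * Real.cosh (x / 2)) * (Real.exp (a / 2) - Real.exp (-(a / 2))))
                * (∑ r ∈ Finset.range J, (-1 : ℝ) ^ r * (a ^ 2 / (4 * π ^ 2)) ^ (r + 1) / (m : ℝ) ^ (2 * r + 2))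
            + ∑ k ∈ Finset.range (q + 1), ((-1 : ℝ) ^ k * (q.descFactorial k : ℝ) * (a / (π * m)) ^ (k + 1)) *
                ( (I ^ (k + 1) *
                      ((∑ n ∈ weilPrimeIndex a, ((Λ n : ℝ) / Real.sqrt n : ℂ) *
                          (((a : ℂ)) ^ (q - k) - (((-a : ℝ)) : ℂ) ^ (q - k)
                            + (((a : ℂ)) ^ (q - k) - (((a - Real.log n : ℝ)) : ℂ) ^ (q - k))
                            + ((((-a + Real.log n : ℝ)) : ℂ) ^ (q - k) - (((-a : ℝ)) : ℂ) ^ (q - k))))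
                        + ((∫ t in Ioc 0 (2 * a), weilArchDensity t *
                            ((a ^ (q - k) - (a - t) ^ (q - k)) + ((-a + t) ^ (q - k) - (-a) ^ (q - k))) : ℝ) : ℂ)
                        + (2 * ((∫ t in Ioi (2 * a), weilArchDensity t : ℝ) : ℂ) - (weilMarkovConstant a : ℂ))
                            * (((a : ℂ)) ^ (q - k) - (((-a : ℝ)) : ℂ) ^ (q - k)))).re
                  + (a ^ (q - k) - (-a) ^ (q - k)) * (I ^ (k + 1)).re *
                      ((Real.log m / 2
                        + (Real.log (π / (2 * a)) / 2 - reDigammaQuarter 0 / 2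
                            - ∑' l : ℕ, Real.exp (-(2 * a * digammaNode l)) / digammaNode l)
                        + ∑ N ∈ Finset.Icc 1 K, (if N % 4 = 0 then (1 : ℝ) else if N % 4 = 2 then -1 else 0)
                            * (1 - 1 / (2 * (N : ℝ))
                                - (∑ l ∈ Finset.Icc 1 ν, (bernoulli (2 * l) : ℝ) / (2 * l) * 16 ^ l
                                    * (((N - 1).choose (2 * l - 1) : ℕ) : ℝ)) / 2)
                            * (a / (2 * π)) ^ N / (m : ℝ) ^ N
                        + ∑ r ∈ Finset.range R, (-1 : ℝ) ^ r *
                            (∑' l : ℕ, Real.exp (-(2 * a * digammaNode l)) * digammaNode l ^ (2 * r + 1))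
                            * (a / π) ^ (2 * r + 2) / (m : ℝ) ^ (2 * r + 2))
                        - ∑ n ∈ weilPrimeIndex a, (Λ n : ℝ) / Real.sqrt n * Real.cos (π * m / a * Real.log n))
                  + (a ^ (q - k) + (-a) ^ (q - k)) * (I ^ (k + 1)).im *
                      ((π / 4
                        + ∑ N ∈ Finset.Icc 1 K, (if N % 4 = 1 then (1 : ℝ) else if N % 4 = 3 then -1 else 0)
                            * (1 - 1 / (2 * (N : ℝ))
                                - (∑ l ∈ Finset.Icc 1 ν, (bernoulli (2 * l) : ℝ) / (2 * l) * 16 ^ l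
                                    * (((N - 1).choose (2 * l - 1) : ℕ) : ℝ)) / 2)
                            * (a / (2 * π)) ^ N / (m : ℝ) ^ N
                        - ∑ r ∈ Finset.range R, (-1 : ℝ) ^ r *
                            (∑' l : ℕ, Real.exp (-(2 * a * digammaNode l)) * digammaNode l ^ (2 * r))
                            * (a / π) ^ (2 * r + 1) / (m : ℝ) ^ (2 * r + 1))
                        + ∑ n ∈ weilPrimeIndex a, (Λ n : ℝ) / Real.sqrt n * Real.sin (π * m / a * Real.log n)) ) )|
      ≤ (1 / Real.sqrt (2 * a)) *
          ( |4 * (∫ x in (-a)..a, x ^ q * Real.cosh (x / 2)) * (Real.exp (a / 2) - Real.exp (-(a / 2)))|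
              * ((a ^ 2 / (4 * π ^ 2)) ^ (J + 1) / (m₀ : ℝ) ^ (2 * J + 2))
            + ∑ k ∈ Finset.range (q + 1), (q.descFactorial k : ℝ) * (a / (π * m₀)) ^ (k + 1) *
                ( |(a ^ (q - k) - (-a) ^ (q - k)) * (I ^ (k + 1)).re| *
                    ((4 * Real.pi ^ 2 / 3 * ((2 * ν + 1).factorial : ℝ) / (2 * Real.pi) ^ (2 * ν + 1)
                      * (4 * (1 / (4 * (π * m₀ / a / 2)))) ^ (2 * ν)
                    + (1 / (4 * (π * m₀ / a / 2))) ^ (K + 1) / ((K + 1) * (1 - 1 / (4 * (π * m₀ / a / 2))))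
                    + 2 * (1 / (4 * (π * m₀ / a / 2))) ^ (K + 1)
                    + ∑ k ∈ Finset.Icc 1 ν, |(bernoulli (2 * k) : ℝ) / (2 * k)| * 2 ^ (K + 1 + 4 * k)
                        * (1 / (4 * (π * m₀ / a / 2))) ^ (K + 1)) / 2
                  + (∑' k : ℕ, Real.exp (-(2 * a * digammaNode k)) * digammaNode k ^ (2 * R + 1))
                      / |π * m₀ / a| ^ (2 * R + 2))
                  + |(a ^ (q - k) + (-a) ^ (q - k)) * (I ^ (k + 1)).im| *
                    ((4 * Real.pi ^ 2 / 3 * ((2 * ν + 1).factorial : ℝ) / (2 * Real.pi) ^ (2 * ν + 1)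
                      * (4 * (1 / (4 * (π * m₀ / a / 2)))) ^ (2 * ν)
                    + (1 / (4 * (π * m₀ / a / 2))) ^ (K + 1) / ((K + 1) * (1 - 1 / (4 * (π * m₀ / a / 2))))
                    + 2 * (1 / (4 * (π * m₀ / a / 2))) ^ (K + 1)
                    + ∑ k ∈ Finset.Icc 1 ν, |(bernoulli (2 * k) : ℝ) / (2 * k)| * 2 ^ (K + 1 + 4 * k)
                        * (1 / (4 * (π * m₀ / a / 2))) ^ (K + 1)) / 2
                  + (∑' k : ℕ, Real.exp (-(2 * a * digammaNode k)) * digammaNode k ^ (2 * R))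
                      / |π * m₀ / a| ^ (2 * R + 1)) ) )
        * ((m₀ : ℝ) / m) ^ (E + 1) := by
  have hπa : 0 < π / a := div_pos Real.pi_pos ha
  have hm₀pos : (0 : ℝ) < m₀ := by
    rcases Nat.eq_zero_or_pos m₀ with h0 | h0
    · exfalso; subst h0; norm_num at hm₀
    · exact_mod_cast h0
  have hmm' : (m₀ : ℝ) ≤ m := by exact_mod_cast hmm
  have hmpos : (0 : ℝ) < m := hm₀pos.trans_le hmm'
  have hmz : (m : ℤ) ≠ 0 := by exact_mod_cast (Nat.pos_iff_ne_zero.1 (by exact_mod_cast hmpos : 0 < m))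
  have hε : |(-1 : ℝ) ^ m| = 1 := by rw [abs_pow, abs_neg, abs_one, one_pow]
  have hc₀ : (0 : ℝ) ≤ 1 / Real.sqrt (2 * a) := by positivity
  have hC := abs_archCos_sub_monomials_le ha hm₀ hmm hν hK R hE1 hE2 (by omega)
  have hS := abs_archSin_sub_monomials_le ha hm₀ hmm hν hK R hE1 hE2 hE3
  have hw : ∀ k ∈ Finset.range (q + 1), |(-1 : ℝ) ^ k * (q.descFactorial k : ℝ) * (a / (π * m)) ^ (k + 1)|
      ≤ (q.descFactorial k : ℝ) * (a / (π * m₀)) ^ (k + 1) := fun k _ ↦ abs_imageWeight_le ha hm₀pos hmm' q k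
  have hX := re_weilWindowSesq_indicator_pow_chi ha hmz q
  simp only [Int.cast_natCast, zpow_natCast] at hX
  have hP0 := abs_polarFactor_int_sub_sum_le ha hmz J
  simp only [Int.cast_natCast, Nat.abs_cast] at hP0
  have hP : |1 / (1 + 4 * (π * (m : ℝ) / a) ^ 2)
        - ∑ r ∈ Finset.range J, (-1 : ℝ) ^ r * (a ^ 2 / (4 * π ^ 2)) ^ (r + 1) / (m : ℝ) ^ (2 * r + 2)|
      ≤ (a ^ 2 / (4 * π ^ 2)) ^ (J + 1) / (m₀ : ℝ) ^ (2 * J + 2) * ((m₀ : ℝ) / m) ^ (E + 1) :=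
    hP0.trans (div_pow_le_scaled (by positivity) hm₀pos hmm' hEJ)
  have key := abs_sub_le_of_image_template (n := q + 1)
    (w := fun k ↦ (-1 : ℝ) ^ k * (q.descFactorial k : ℝ) * (a / (π * m)) ^ (k + 1))
    (K := fun k ↦ (I ^ (k + 1) *
                      ((∑ n ∈ weilPrimeIndex a, ((Λ n : ℝ) / Real.sqrt n : ℂ) *
                          (((a : ℂ)) ^ (q - k) - (((-a : ℝ)) : ℂ) ^ (q - k)
                            + (((a : ℂ)) ^ (q - k) - (((a - Real.log n : ℝ)) : ℂ) ^ (q - k))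
                            + ((((-a + Real.log n : ℝ)) : ℂ) ^ (q - k) - (((-a : ℝ)) : ℂ) ^ (q - k))))
                        + ((∫ t in Ioc 0 (2 * a), weilArchDensity t *
                            ((a ^ (q - k) - (a - t) ^ (q - k)) + ((-a + t) ^ (q - k) - (-a) ^ (q - k))) : ℝ) : ℂ)
                        + (2 * ((∫ t in Ioi (2 * a), weilArchDensity t : ℝ) : ℂ) - (weilMarkovConstant a : ℂ))
                            * (((a : ℂ)) ^ (q - k) - (((-a : ℝ)) : ℂ) ^ (q - k)))).re)
    (α := fun k ↦ (a ^ (q - k) - (-a) ^ (q - k)) * (I ^ (k + 1)).re)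
    (β := fun k ↦ (a ^ (q - k) + (-a) ^ (q - k)) * (I ^ (k + 1)).im)
    (W := fun k ↦ (q.descFactorial k : ℝ) * (a / (π * m₀)) ^ (k + 1))
    hc₀ hε hX hP hC hS hw
  beta_reduce at key
  exact key

/-! ## The odd images `Im W_a(1x^q, χ_m)` -/

/-- **The imaginary part of the image of `x^q` as a monomial sum** (`a > 0`; natural modes `m ≥ m₀`, `πm₀/a ≥ 2`;
`ν ≥ 1`, `2ν ≤ K`; uniform order `E` with `E + 1 ≤ 2ν`, `E ≤ K`, `E ≤ 2R`, `E ≤ 2J`): the formula of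
`im_weilWindowSesq_indicator_pow_chi` with the odd polar factor, `J_c(m)` and `J_s(m)` replaced by their monomial
sums, up to `(2a)^{-1/2}·ρ_im(q,m₀)·(m₀/m)^{E+1}`. -/
theorem abs_im_image_pow_sub_monomials_le (ha : 0 < a) {m₀ m : ℕ} (hm₀ : 2 ≤ π * m₀ / a) (hmm : m₀ ≤ m)
    (q : ℕ) {ν : ℕ} (hν : ν ≠ 0) {K : ℕ} (hK : 2 * ν ≤ K) (R J : ℕ) {E : ℕ} (hE1 : E + 1 ≤ 2 * ν)
    (hE2 : E ≤ K) (hE3 : E ≤ 2 * R) (hEJ : E ≤ 2 * J) :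
    |(weilWindowSesq a ((Icc (-a) a).indicator fun x : ℝ ↦ ((x : ℂ)) ^ q) (chi a m)).im
        - (1 / Real.sqrt (2 * a)) * (-1 : ℝ) ^ m *
          ( -((8 * (∫ x in (-a)..a, x ^ q * Real.sinh (x / 2)) * (Real.exp (a / 2) - Real.exp (-(a / 2))))
                * (∑ r ∈ Finset.range J, (-1 : ℝ) ^ r * (a / (4 * π)) * (a ^ 2 / (4 * π ^ 2)) ^ r
                    / (m : ℝ) ^ (2 * r + 1)))
            + ∑ k ∈ Finset.range (q + 1), ((-1 : ℝ) ^ k * (q.descFactorial k : ℝ) * (a / (π * m)) ^ (k + 1)) *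
                ( (I ^ (k + 1) *
                      ((∑ n ∈ weilPrimeIndex a, ((Λ n : ℝ) / Real.sqrt n : ℂ) *
                          (((a : ℂ)) ^ (q - k) - (((-a : ℝ)) : ℂ) ^ (q - k)
                            + (((a : ℂ)) ^ (q - k) - (((a - Real.log n : ℝ)) : ℂ) ^ (q - k))
                            + ((((-a + Real.log n : ℝ)) : ℂ) ^ (q - k) - (((-a : ℝ)) : ℂ) ^ (q - k))))
                        + ((∫ t in Ioc 0 (2 * a), weilArchDensity t *
                            ((a ^ (q - k) - (a - t) ^ (q - k)) + ((-a + t) ^ (q - k) - (-a) ^ (q - k))) : ℝ) : ℂ)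
                        + (2 * ((∫ t in Ioi (2 * a), weilArchDensity t : ℝ) : ℂ) - (weilMarkovConstant a : ℂ))
                            * (((a : ℂ)) ^ (q - k) - (((-a : ℝ)) : ℂ) ^ (q - k)))).im
                  + (a ^ (q - k) - (-a) ^ (q - k)) * (I ^ (k + 1)).im *
                      ((Real.log m / 2
                        + (Real.log (π / (2 * a)) / 2 - reDigammaQuarter 0 / 2
                            - ∑' l : ℕ, Real.exp (-(2 * a * digammaNode l)) / digammaNode l)
                        + ∑ N ∈ Finset.Icc 1 K, (if N % 4 = 0 then (1 : ℝ) else if N % 4 = 2 then -1 else 0)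
                            * (1 - 1 / (2 * (N : ℝ))
                                - (∑ l ∈ Finset.Icc 1 ν, (bernoulli (2 * l) : ℝ) / (2 * l) * 16 ^ l
                                    * (((N - 1).choose (2 * l - 1) : ℕ) : ℝ)) / 2)
                            * (a / (2 * π)) ^ N / (m : ℝ) ^ N
                        + ∑ r ∈ Finset.range R, (-1 : ℝ) ^ r *
                            (∑' l : ℕ, Real.exp (-(2 * a * digammaNode l)) * digammaNode l ^ (2 * r + 1))
                            * (a / π) ^ (2 * r + 2) / (m : ℝ) ^ (2 * r + 2))
                        - ∑ n ∈ weilPrimeIndex a, (Λ n : ℝ) / Real.sqrt n * Real.cos (π * m / a * Real.log n))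
                  - (a ^ (q - k) + (-a) ^ (q - k)) * (I ^ (k + 1)).re *
                      ((π / 4
                        + ∑ N ∈ Finset.Icc 1 K, (if N % 4 = 1 then (1 : ℝ) else if N % 4 = 3 then -1 else 0)
                            * (1 - 1 / (2 * (N : ℝ))
                                - (∑ l ∈ Finset.Icc 1 ν, (bernoulli (2 * l) : ℝ) / (2 * l) * 16 ^ l
                                    * (((N - 1).choose (2 * l - 1) : ℕ) : ℝ)) / 2)
                            * (a / (2 * π)) ^ N / (m : ℝ) ^ N
                        - ∑ r ∈ Finset.range R, (-1 : ℝ) ^ r *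
                            (∑' l : ℕ, Real.exp (-(2 * a * digammaNode l)) * digammaNode l ^ (2 * r))
                            * (a / π) ^ (2 * r + 1) / (m : ℝ) ^ (2 * r + 1))
                        + ∑ n ∈ weilPrimeIndex a, (Λ n : ℝ) / Real.sqrt n * Real.sin (π * m / a * Real.log n)) ) )|
      ≤ (1 / Real.sqrt (2 * a)) *
          ( |8 * (∫ x in (-a)..a, x ^ q * Real.sinh (x / 2)) * (Real.exp (a / 2) - Real.exp (-(a / 2)))|
              * (a / (4 * π) * (a ^ 2 / (4 * π ^ 2)) ^ J / (m₀ : ℝ) ^ (2 * J + 1))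
            + ∑ k ∈ Finset.range (q + 1), (q.descFactorial k : ℝ) * (a / (π * m₀)) ^ (k + 1) *
                ( |(a ^ (q - k) - (-a) ^ (q - k)) * (I ^ (k + 1)).im| *
                    ((4 * Real.pi ^ 2 / 3 * ((2 * ν + 1).factorial : ℝ) / (2 * Real.pi) ^ (2 * ν + 1)
                      * (4 * (1 / (4 * (π * m₀ / a / 2)))) ^ (2 * ν)
                    + (1 / (4 * (π * m₀ / a / 2))) ^ (K + 1) / ((K + 1) * (1 - 1 / (4 * (π * m₀ / a / 2))))
                    + 2 * (1 / (4 * (π * m₀ / a / 2))) ^ (K + 1)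
                    + ∑ k ∈ Finset.Icc 1 ν, |(bernoulli (2 * k) : ℝ) / (2 * k)| * 2 ^ (K + 1 + 4 * k)
                        * (1 / (4 * (π * m₀ / a / 2))) ^ (K + 1)) / 2
                  + (∑' k : ℕ, Real.exp (-(2 * a * digammaNode k)) * digammaNode k ^ (2 * R + 1))
                      / |π * m₀ / a| ^ (2 * R + 2))
                  + |(a ^ (q - k) + (-a) ^ (q - k)) * (I ^ (k + 1)).re| *
                    ((4 * Real.pi ^ 2 / 3 * ((2 * ν + 1).factorial : ℝ) / (2 * Real.pi) ^ (2 * ν + 1)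
                      * (4 * (1 / (4 * (π * m₀ / a / 2)))) ^ (2 * ν)
                    + (1 / (4 * (π * m₀ / a / 2))) ^ (K + 1) / ((K + 1) * (1 - 1 / (4 * (π * m₀ / a / 2))))
                    + 2 * (1 / (4 * (π * m₀ / a / 2))) ^ (K + 1)
                    + ∑ k ∈ Finset.Icc 1 ν, |(bernoulli (2 * k) : ℝ) / (2 * k)| * 2 ^ (K + 1 + 4 * k)
                        * (1 / (4 * (π * m₀ / a / 2))) ^ (K + 1)) / 2
                  + (∑' k : ℕ, Real.exp (-(2 * a * digammaNode k)) * digammaNode k ^ (2 * R))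
                      / |π * m₀ / a| ^ (2 * R + 1)) ) )
        * ((m₀ : ℝ) / m) ^ (E + 1) := by
  have hπa : 0 < π / a := div_pos Real.pi_pos ha
  have hm₀pos : (0 : ℝ) < m₀ := by
    rcases Nat.eq_zero_or_pos m₀ with h0 | h0
    · exfalso; subst h0; norm_num at hm₀
    · exact_mod_cast h0
  have hmm' : (m₀ : ℝ) ≤ m := by exact_mod_cast hmm
  have hmpos : (0 : ℝ) < m := hm₀pos.trans_le hmm'
  have hmz : (m : ℤ) ≠ 0 := by exact_mod_cast (Nat.pos_iff_ne_zero.1 (by exact_mod_cast hmpos : 0 < m))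
  have hε : |(-1 : ℝ) ^ m| = 1 := by rw [abs_pow, abs_neg, abs_one, one_pow]
  have hc₀ : (0 : ℝ) ≤ 1 / Real.sqrt (2 * a) := by positivity
  have hC := abs_archCos_sub_monomials_le ha hm₀ hmm hν hK R hE1 hE2 (by omega)
  have hS := abs_archSin_sub_monomials_le ha hm₀ hmm hν hK R hE1 hE2 hE3
  have hw : ∀ k ∈ Finset.range (q + 1), |(-1 : ℝ) ^ k * (q.descFactorial k : ℝ) * (a / (π * m)) ^ (k + 1)|
      ≤ (q.descFactorial k : ℝ) * (a / (π * m₀)) ^ (k + 1) := fun k _ ↦ abs_imageWeight_le ha hm₀pos hmm' q k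
  have hX0 := im_weilWindowSesq_indicator_pow_chi ha hmz q
  simp only [Int.cast_natCast, zpow_natCast] at hX0
  -- bring the identity to the template's shape (`A·P` with `A = −8S_q s`, `+ (−β)·F`)
  have hX : (weilWindowSesq a ((Icc (-a) a).indicator fun x : ℝ ↦ ((x : ℂ)) ^ q) (chi a m)).im
      = (1 / Real.sqrt (2 * a)) * (-1 : ℝ) ^ m *
          ( (-(8 * (∫ x in (-a)..a, x ^ q * Real.sinh (x / 2)) * (Real.exp (a / 2) - Real.exp (-(a / 2)))))
                * ((π * m / a) / (1 + 4 * (π * m / a) ^ 2))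
            + ∑ k ∈ Finset.range (q + 1), ((-1 : ℝ) ^ k * (q.descFactorial k : ℝ) * (a / (π * m)) ^ (k + 1)) *
                ( (I ^ (k + 1) *
                      ((∑ n ∈ weilPrimeIndex a, ((Λ n : ℝ) / Real.sqrt n : ℂ) *
                          (((a : ℂ)) ^ (q - k) - (((-a : ℝ)) : ℂ) ^ (q - k)
                            + (((a : ℂ)) ^ (q - k) - (((a - Real.log n : ℝ)) : ℂ) ^ (q - k))
                            + ((((-a + Real.log n : ℝ)) : ℂ) ^ (q - k) - (((-a : ℝ)) : ℂ) ^ (q - k))))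
                        + ((∫ t in Ioc 0 (2 * a), weilArchDensity t *
                            ((a ^ (q - k) - (a - t) ^ (q - k)) + ((-a + t) ^ (q - k) - (-a) ^ (q - k))) : ℝ) : ℂ)
                        + (2 * ((∫ t in Ioi (2 * a), weilArchDensity t : ℝ) : ℂ) - (weilMarkovConstant a : ℂ))
                            * (((a : ℂ)) ^ (q - k) - (((-a : ℝ)) : ℂ) ^ (q - k)))).im
                  + (a ^ (q - k) - (-a) ^ (q - k)) * (I ^ (k + 1)).im *
                      ((∫ t in Ioc 0 (2 * a), weilArchDensity t * (1 - Real.cos (π * m / a * t)))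
                        - ∑ n ∈ weilPrimeIndex a, (Λ n : ℝ) / Real.sqrt n * Real.cos (π * m / a * Real.log n))
                  + (-((a ^ (q - k) + (-a) ^ (q - k)) * (I ^ (k + 1)).re)) *
                      ((∫ t in Ioc 0 (2 * a), weilArchDensity t * Real.sin (π * m / a * t))
                        + ∑ n ∈ weilPrimeIndex a, (Λ n : ℝ) / Real.sqrt n * Real.sin (π * m / a * Real.log n)) ) ) := by
    rw [hX0]
    congr 1
    rw [neg_mul]
    congr 1
    exact Finset.sum_congr rfl fun k _ ↦ by ring
  have hP0 := abs_oddPolarFactor_int_sub_sum_le ha hmz J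
  simp only [Int.cast_natCast, Nat.abs_cast] at hP0
  have hP : |(π * (m : ℝ) / a) / (1 + 4 * (π * (m : ℝ) / a) ^ 2)
        - ∑ r ∈ Finset.range J, (-1 : ℝ) ^ r * (a / (4 * π)) * (a ^ 2 / (4 * π ^ 2)) ^ r
            / (m : ℝ) ^ (2 * r + 1)|
      ≤ a / (4 * π) * (a ^ 2 / (4 * π ^ 2)) ^ J / (m₀ : ℝ) ^ (2 * J + 1) * ((m₀ : ℝ) / m) ^ (E + 1) :=
    hP0.trans (div_pow_le_scaled (by positivity) hm₀pos hmm' (by omega))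
  have key := abs_sub_le_of_image_template (n := q + 1)
    (w := fun k ↦ (-1 : ℝ) ^ k * (q.descFactorial k : ℝ) * (a / (π * m)) ^ (k + 1))
    (K := fun k ↦ (I ^ (k + 1) *
                      ((∑ n ∈ weilPrimeIndex a, ((Λ n : ℝ) / Real.sqrt n : ℂ) *
                          (((a : ℂ)) ^ (q - k) - (((-a : ℝ)) : ℂ) ^ (q - k)
                            + (((a : ℂ)) ^ (q - k) - (((a - Real.log n : ℝ)) : ℂ) ^ (q - k))
                            + ((((-a + Real.log n : ℝ)) : ℂ) ^ (q - k) - (((-a : ℝ)) : ℂ) ^ (q - k))))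
                        + ((∫ t in Ioc 0 (2 * a), weilArchDensity t *
                            ((a ^ (q - k) - (a - t) ^ (q - k)) + ((-a + t) ^ (q - k) - (-a) ^ (q - k))) : ℝ) : ℂ)
                        + (2 * ((∫ t in Ioi (2 * a), weilArchDensity t : ℝ) : ℂ) - (weilMarkovConstant a : ℂ))
                            * (((a : ℂ)) ^ (q - k) - (((-a : ℝ)) : ℂ) ^ (q - k)))).im)
    (α := fun k ↦ (a ^ (q - k) - (-a) ^ (q - k)) * (I ^ (k + 1)).im)
    (β := fun k ↦ -((a ^ (q - k) + (-a) ^ (q - k)) * (I ^ (k + 1)).re))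
    (W := fun k ↦ (q.descFactorial k : ℝ) * (a / (π * m₀)) ^ (k + 1))
    hc₀ hε hX hP hC hS hw
  beta_reduce at key
  simp only [abs_neg, neg_mul] at key
  -- back to the printed shape (`−(8S_q s)·(polar sum)`, `− β·(J_s' + S)`)
  have e : ∀ (Pa : ℝ) (G F : ℕ → ℝ),
      (1 / Real.sqrt (2 * a)) * (-1 : ℝ) ^ m *
          ( -(8 * (∫ x in (-a)..a, x ^ q * Real.sinh (x / 2)) * (Real.exp (a / 2) - Real.exp (-(a / 2))) * Pa)
            + ∑ k ∈ Finset.range (q + 1), ((-1 : ℝ) ^ k * (q.descFactorial k : ℝ) * (a / (π * m)) ^ (k + 1)) *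
                ( (I ^ (k + 1) *
                      ((∑ n ∈ weilPrimeIndex a, ((Λ n : ℝ) / Real.sqrt n : ℂ) *
                          (((a : ℂ)) ^ (q - k) - (((-a : ℝ)) : ℂ) ^ (q - k)
                            + (((a : ℂ)) ^ (q - k) - (((a - Real.log n : ℝ)) : ℂ) ^ (q - k))
                            + ((((-a + Real.log n : ℝ)) : ℂ) ^ (q - k) - (((-a : ℝ)) : ℂ) ^ (q - k))))
                        + ((∫ t in Ioc 0 (2 * a), weilArchDensity t *
                            ((a ^ (q - k) - (a - t) ^ (q - k)) + ((-a + t) ^ (q - k) - (-a) ^ (q - k))) : ℝ) : ℂ)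
                        + (2 * ((∫ t in Ioi (2 * a), weilArchDensity t : ℝ) : ℂ) - (weilMarkovConstant a : ℂ))
                            * (((a : ℂ)) ^ (q - k) - (((-a : ℝ)) : ℂ) ^ (q - k)))).im
                  + (a ^ (q - k) - (-a) ^ (q - k)) * (I ^ (k + 1)).im * G k
                  + -((a ^ (q - k) + (-a) ^ (q - k)) * (I ^ (k + 1)).re * F k) ) )
        = (1 / Real.sqrt (2 * a)) * (-1 : ℝ) ^ m *
          ( -((8 * (∫ x in (-a)..a, x ^ q * Real.sinh (x / 2)) * (Real.exp (a / 2) - Real.exp (-(a / 2)))) * Pa)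
            + ∑ k ∈ Finset.range (q + 1), ((-1 : ℝ) ^ k * (q.descFactorial k : ℝ) * (a / (π * m)) ^ (k + 1)) *
                ( (I ^ (k + 1) *
                      ((∑ n ∈ weilPrimeIndex a, ((Λ n : ℝ) / Real.sqrt n : ℂ) *
                          (((a : ℂ)) ^ (q - k) - (((-a : ℝ)) : ℂ) ^ (q - k)
                            + (((a : ℂ)) ^ (q - k) - (((a - Real.log n : ℝ)) : ℂ) ^ (q - k))
                            + ((((-a + Real.log n : ℝ)) : ℂ) ^ (q - k) - (((-a : ℝ)) : ℂ) ^ (q - k))))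
                        + ((∫ t in Ioc 0 (2 * a), weilArchDensity t *
                            ((a ^ (q - k) - (a - t) ^ (q - k)) + ((-a + t) ^ (q - k) - (-a) ^ (q - k))) : ℝ) : ℂ)
                        + (2 * ((∫ t in Ioi (2 * a), weilArchDensity t : ℝ) : ℂ) - (weilMarkovConstant a : ℂ))
                            * (((a : ℂ)) ^ (q - k) - (((-a : ℝ)) : ℂ) ^ (q - k)))).im
                  + (a ^ (q - k) - (-a) ^ (q - k)) * (I ^ (k + 1)).im * G k
                  - (a ^ (q - k) + (-a) ^ (q - k)) * (I ^ (k + 1)).re * F k ) ) := by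
    intro Pa G F
    congr 1
  rw [e] at key
  exact key

end Summit.RiemannHypothesis.RiemannHypothesis.Theorems.WeilFormatC
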